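import Literature.Barriers.BirchSwinnertonDyer.RankNotSumOfLocalInvariants480a1Proofs
import Literature.NumberTheory.EllipticCurves.Curve24A1Descent
import HarnessLib

/-!
# `480a1` has Mordell–Weil rank exactly `1` over `ℚ`: the complete `2`-descent, carried out

Companion to `RankNotSumOfLocalInvariants480a1Proofs.lean` (the curve
`curve480a1 : y² = x(x + 2)(x - 3)`, Cremona label `480a1`, of the proof of Theorem 2 of
T. Dokchitser–V. Dokchitser, *A note on the Mordell–Weil rank modulo `n`*, J. Number Theory 131
(2011) 1833–1839, arXiv:0910.4588, and its rational point `P = (-1, 2)` of infinite order) and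
second input of the INDEPENDENT reduction of the rank leaf
`Literature.Barriers.BirchSwinnertonDyer.DokchitserDokchitser2011_mordellWeilRank_480a1_F5`
("2-descent shows that `rk E/F₅ = 1`") through the Artin formalism of
`Literature/NumberTheory/EllipticCurves/CyclicPrimeDegreeRank.lean`
(`rk E(K) = rk E(ℚ) + 4d` for the quintic subfields `K ⊂ F₅`): the EXACT rank over `ℚ`,

* `curve480a1.mordellWeilRank_le_one : rank_ℤ E(ℚ) ≤ 1` (complete `2`-descent over `ℚ`),
* `curve480a1.mordellWeilRank_eq_one : rank_ℤ E(ℚ) = 1` (with the point of infinite order),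

so that a bound `rk E(K) ≤ 4` over a quintic subfield already forces `rk E(K) = 1`. This is
Cremona's table entry `r = 1` for `480a1`, certified in Lean by the method of Silverman, *AEC*,
Prop. X.1.4 / Example X.1.5, exactly as for `24A1` in
`Literature/NumberTheory/EllipticCurves/Curve24A1Descent.lean` (whose arithmetic lemmas are
reused), using only proved material of the tree: the `2`-descent homomorphism
`δ = (x, x + 2) : E(ℚ) → ℚˣ/ℚˣ² × ℚˣ/ℚˣ²` with kernel `2E(ℚ)` (`TwoDescent.lean`), the
Mordell–Weil theorem (`WeierstrassCurve.module_finite_point_holds`) and the counting lemma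
`2^(r+2) ≤ #δ(E(ℚ))` (`TwoDescentRankBounds.lean`).

## The descent (all proved here; `e₁ = 0, e₂ = -2, e₃ = 3`, `S = {2, 3, 5, ∞}`)

For a rational point `(x, y)` with `y ≠ 0`:
1. `ord_p(x)` is even for `p ∉ {2, 3}`, `ord_p(x + 2)` is even for `p ∉ {2, 5}`, `ord_p(x - 3)`
   is even for `p ∉ {3, 5}` (`Curve24A1.even_padicValRat_sub`);
2. hence `|x| = 2ᵃ g₁ u²`, `g₁ ∈ {1, 3}`, and `x + 2 = 2ᵇ g₂ v²`, `g₂ ∈ {1, 5}` (`x + 2 > 0` since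
   `y² > 0`), with `a, b ∈ {0, 1}` (`exists_abs_eq_two_pow_mul_sq`) and `a = b` because
   `ord₂ x + ord₂(x + 2) + ord₂(x - 3) = 2 ord₂ y` with `ord₂(x - 3)` even;
3. of the `16` remaining pairs `(x, x + 2) ≡ (±2ᵃg₁, 2ᵃg₂)`, eight are excluded by a `3`-adic or
   `5`-adic obstruction on the corresponding homogeneous space, in the elementary form of an
   infinite descent modulo `q ∈ {3, 5}` on `αa² + βb² = qγc²` (`eq_zero_of_sq_descent_prime`,
   the prime-`q` version of `Curve24A1.eq_zero_of_sq_descent`): `u² + 2 = 5v²`, `2 - u² = 5v²`,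
   `3u² + 1 = 5v²`, `1 - 3u² = 5v²`, `3u² + 2 = v²`, `2 - 3u² = v²`, `2u² - 3 = w²`,
   `2u² + 3 = w²` have no rational solutions;
4. so `δ(E(ℚ)) ⊆ {(1,1), (3,5), (-1,1), (-3,5), (2,10), (6,2), (-2,10), (-6,2)}`
   (`descentPair_mem`; these are the classes of `O`, `(3,0)`, `±P`, `±P + (3,0)`, `±P + (-2,0)`,
   `±P + (0,0)`, `(-2,0)`, `(0,0)`), a set of `8` classes, whence `2^(r+2) ≤ 8`, `r ≤ 1`
   (`mordellWeilRank_le_one`, with `T₁ = (0, 0)`, `T₂ = (-2, 0)` as the two torsion points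
   separated by `δ`), and `r = 1` as `P = (-1, 2)` has infinite order (`mordellWeilRank_eq_one`).

## Design

* Theorems only (no definitions, no named facts). As in `Curve24A1Descent.lean`, statements
  about points are polymorphic in the `DecidableEq ℚ` instance or avoid the group law; inside
  the rank proofs the group law on `E(ℚ)` is elaborated against the classical instance
  (`letI := Classical.decEq ℚ`), the one carried by `WeierstrassCurve.mordellWeilRank` and by the
  general-field theorems of `MordellWeilTheoremProofs.lean` / `TwoDescentRankBounds.lean`;
  `nsmul_P_ne_zero'` transports the infinite order of `P` (stated in
  `RankNotSumOfLocalInvariants480a1Proofs.lean` for `ℚ`'s computable instance) along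
  `Subsingleton (DecidableEq ℚ)`.
* Helper lemmas in `namespace Literature.Barriers.BirchSwinnertonDyer.curve480a1`.
* What is NOT here: any descent over the quintic subfields of `F₅` (no `S`-unit / class-group
  computations for number fields exist in Lean); see `RankNotSumOfLocalInvariantsF5.lean`.

## References

* T. Dokchitser, V. Dokchitser, *A note on the Mordell–Weil rank modulo `n`*, J. Number Theory
  131 (2011) 1833–1839, arXiv:0910.4588, proof of Thm. 2 ("`E/ℚ : y² = x(x+2)(x-3)`, which is
  480a1 […] 2-descent shows that `rk E/F₃ = rk E/F₅ = 1`"). [DokchitserDokchitser2011RankModN]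
* J. H. Silverman, *The Arithmetic of Elliptic Curves*, 2nd ed., GTM 106 (2009): Prop. X.1.4
  (complete `2`-descent), Example X.1.5; Thm. VIII.6.7. [SilvermanAEC2009]
* J. E. Cremona, *Algorithms for Modular Elliptic Curves*, 2nd ed., CUP 1997: Table 1 (rank
  `1` for `480a1`), §3.6 (descent). [CremonaAlgorithms1997]
-/

noncomputable section

open scoped Classical

open WeierstrassCurve WeierstrassCurve.Affine WeierstrassCurve.Affine.Point
open Literature.NumberTheory.EllipticCurves Literature.NumberTheory.EllipticCurves.Curve24A1

namespace Literature.Barriers.BirchSwinnertonDyer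

namespace curve480a1

/-! ### Arithmetic: descent modulo a prime `q`, square classes away from two primes -/

/-- **Lifting a congruence modulo a prime `q`**: if the binary form `αa² + βb²` is anisotropic
modulo `q` (hypothesis `H`, decidable for numerical `α, β, q`), then `q ∣ αa² + βb²` forces
`q ∣ a` and `q ∣ b`. (The case `q = 3` is `Curve24A1.three_dvd_of_zmod`.) [folklore] -/
theorem prime_dvd_of_zmod (q : ℕ) {α β : ℤ}
    (H : ∀ a b : ZMod q, (α : ZMod q) * a ^ 2 + (β : ZMod q) * b ^ 2 = 0 → a = 0 ∧ b = 0)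
    {a b : ℤ} (h : (q : ℤ) ∣ α * a ^ 2 + β * b ^ 2) : (q : ℤ) ∣ a ∧ (q : ℤ) ∣ b := by
  have h' : (α : ZMod q) * (a : ZMod q) ^ 2 + (β : ZMod q) * (b : ZMod q) ^ 2 = 0 := by
    have := (ZMod.intCast_zmod_eq_zero_iff_dvd _ q).mpr h
    push_cast at this
    exact this
  obtain ⟨ha, hb⟩ := H _ _ h'
  exact ⟨(ZMod.intCast_zmod_eq_zero_iff_dvd a q).mp ha, (ZMod.intCast_zmod_eq_zero_iff_dvd b q).mp hb⟩

/-- **Infinite descent modulo a prime `q`** (the `q`-adic local obstruction of the `2`-descent, in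
Fermat's form): if `αa² + βb²` is anisotropic modulo the prime `q` and `q ∤ γ`, then the only
integer solution of `αa² + βb² = qγc²` is `a = b = c = 0`: modulo `q`, `q ∣ a, b`; then
`q² ∣ qγc²` gives `q ∣ c`, and `(a/q, b/q, c/q)` is a smaller solution. (The case `q = 3` is
`Curve24A1.eq_zero_of_sq_descent`.) [folklore] -/
theorem eq_zero_of_sq_descent_prime (q : ℕ) [hq : Fact q.Prime] {α β γ : ℤ}
    (H : ∀ a b : ZMod q, (α : ZMod q) * a ^ 2 + (β : ZMod q) * b ^ 2 = 0 → a = 0 ∧ b = 0)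
    (hγ : ¬(q : ℤ) ∣ γ) {a b c : ℤ} (h : α * a ^ 2 + β * b ^ 2 = q * γ * c ^ 2) :
    a = 0 ∧ b = 0 ∧ c = 0 := by
  have hqp : Prime (q : ℤ) := Nat.prime_iff_prime_int.mp hq.out
  have hq0 : (q : ℤ) ≠ 0 := hqp.ne_zero
  suffices key : ∀ (n : ℕ) (a b c : ℤ), a.natAbs + b.natAbs + c.natAbs ≤ n →
      α * a ^ 2 + β * b ^ 2 = q * γ * c ^ 2 → a = 0 ∧ b = 0 ∧ c = 0 from
    key _ a b c le_rfl h
  intro n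
  induction n with
  | zero =>
    intro a b c hn _
    omega
  | succ n ih =>
    intro a b c hn h
    obtain ⟨⟨a', rfl⟩, ⟨b', rfl⟩⟩ :=
      prime_dvd_of_zmod q H (a := a) (b := b) ⟨γ * c ^ 2, by rw [h]; ring⟩
    have h3 : γ * c ^ 2 = q * (α * a' ^ 2 + β * b' ^ 2) := by
      have : (q : ℤ) * (γ * c ^ 2) = q * (q * (α * a' ^ 2 + β * b' ^ 2)) := by
        linear_combination h.symm
      exact mul_left_cancel₀ hq0 this
    have h3c : (q : ℤ) ∣ c := by
      have h9 : (q : ℤ) ∣ γ * c ^ 2 := ⟨_, h3⟩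
      rcases hqp.dvd_or_dvd h9 with h3' | h3'
      · exact absurd h3' hγ
      · exact hqp.dvd_of_dvd_pow h3'
    obtain ⟨c', rfl⟩ := h3c
    have h' : α * a' ^ 2 + β * b' ^ 2 = q * γ * c' ^ 2 := by
      have : (q : ℤ) * (α * a' ^ 2 + β * b' ^ 2) = q * (q * γ * c' ^ 2) := by
        linear_combination h3.symm
      exact mul_left_cancel₀ hq0 this
    by_cases h0 : a' = 0 ∧ b' = 0 ∧ c' = 0
    · obtain ⟨rfl, rfl, rfl⟩ := h0
      simp
    · simp only [Int.natAbs_mul, Int.natAbs_natCast] at hn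
      have hq2 : 2 ≤ q := hq.out.two_le
      have : a'.natAbs + b'.natAbs + c'.natAbs ≤ n := by
        have hsum : 0 < a'.natAbs + b'.natAbs + c'.natAbs := by
          rcases not_and_or.mp h0 with h1 | h1
          · have := Int.natAbs_pos.mpr h1; omega
          · rcases not_and_or.mp h1 with h2 | h2
            · have := Int.natAbs_pos.mpr h2; omega
            · have := Int.natAbs_pos.mpr h2; omega
        nlinarith
      exact absurd (ih a' b' c' this h') h0

/-- **The rational form of the descent**: under the same hypotheses, `αa² + βb² = qγc²` has no
rational solution other than `a = b = c = 0` (clear denominators). [folklore] -/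
theorem eq_zero_of_sq_descent_prime_rat (q : ℕ) [Fact q.Prime] {α β γ : ℤ}
    (H : ∀ a b : ZMod q, (α : ZMod q) * a ^ 2 + (β : ZMod q) * b ^ 2 = 0 → a = 0 ∧ b = 0)
    (hγ : ¬(q : ℤ) ∣ γ) {a b c : ℚ} (h : (α : ℚ) * a ^ 2 + β * b ^ 2 = q * γ * c ^ 2) :
    a = 0 ∧ b = 0 ∧ c = 0 := by
  set D : ℚ := (a.den : ℚ) * b.den * c.den with hD
  have hD0 : D ≠ 0 := by rw [hD]; positivity
  have ha : a * D = ((a.num * b.den * c.den : ℤ) : ℚ) := by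
    push_cast; rw [hD, ← Rat.mul_den_eq_num a]; ring
  have hb : b * D = ((b.num * a.den * c.den : ℤ) : ℚ) := by
    push_cast; rw [hD, ← Rat.mul_den_eq_num b]; ring
  have hc : c * D = ((c.num * a.den * b.den : ℤ) : ℚ) := by
    push_cast; rw [hD, ← Rat.mul_den_eq_num c]; ring
  have key : (α : ℚ) * (a * D) ^ 2 + β * (b * D) ^ 2 = q * γ * (c * D) ^ 2 := by
    linear_combination D ^ 2 * h
  rw [ha, hb, hc] at key
  have key' : α * (a.num * b.den * c.den) ^ 2 + β * (b.num * a.den * c.den) ^ 2 =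
      q * γ * (c.num * a.den * b.den) ^ 2 := by
    exact_mod_cast key
  obtain ⟨h1, h2, h3⟩ := eq_zero_of_sq_descent_prime q H hγ key'
  refine ⟨?_, ?_, ?_⟩
  · have : a * D = 0 := by rw [ha, h1, Int.cast_zero]
    exact (mul_eq_zero.mp this).resolve_right hD0
  · have : b * D = 0 := by rw [hb, h2, Int.cast_zero]
    exact (mul_eq_zero.mp this).resolve_right hD0
  · have : c * D = 0 := by rw [hc, h3, Int.cast_zero]
    exact (mul_eq_zero.mp this).resolve_right hD0

/-- **Square classes away from `2` and `q`**: if `r ≠ 0` and `ord_p(r)` is even for every prime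
`p ∉ {2, q}`, then `|r| = 2ᵃ u²` or `|r| = 2ᵃ q u²` with `a ∈ {0, 1}` of the parity of `ord₂(r)`.
[folklore] -/
theorem exists_abs_eq_two_pow_mul_sq {r : ℚ} (hr : r ≠ 0) (q : ℕ) [hq : Fact q.Prime]
    (h : ∀ p : ℕ, p.Prime → p ≠ 2 → p ≠ q → Even (padicValRat p r)) :
    ∃ (a : ℕ) (u : ℚ), a ≤ 1 ∧ (a : ℤ) ≡ padicValRat 2 r [ZMOD 2] ∧
      (|r| = 2 ^ a * u ^ 2 ∨ |r| = 2 ^ a * q * u ^ 2) := by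
  haveI : Fact (Nat.Prime 2) := ⟨Nat.prime_two⟩
  -- `a` = parity of `ord₂ r`, `r' = r / 2ᵃ`
  obtain ⟨a, ha1, hamod⟩ : ∃ a : ℕ, a ≤ 1 ∧ (a : ℤ) ≡ padicValRat 2 r [ZMOD 2] :=
    ⟨(padicValRat 2 r).natMod 2, Nat.lt_succ_iff.mp (Int.natMod_lt two_ne_zero), by
      rw [Int.ModEq, Int.natMod, Int.toNat_of_nonneg (Int.emod_nonneg _ two_ne_zero),
        Int.emod_emod_of_dvd _ dvd_rfl]⟩
  set r' : ℚ := r / 2 ^ a with hr'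
  have h2a : (2 : ℚ) ^ a ≠ 0 := pow_ne_zero a two_ne_zero
  have hr'0 : r' ≠ 0 := div_ne_zero hr h2a
  have hval : ∀ p : ℕ, p.Prime → padicValRat p r' =
      padicValRat p r - a * padicValRat p (2 : ℚ) := fun p hp => by
    haveI := Fact.mk hp
    rw [hr', padicValRat.div hr h2a, padicValRat.pow]
  obtain ⟨u, hu⟩ := exists_abs_eq_sq_or hr'0 q fun p hp hpq => by
    rw [hval p hp]
    by_cases hp2 : p = 2
    · subst hp2
      rw [show (2 : ℚ) = ((2 : ℕ) : ℚ) by norm_num, padicValRat.of_nat, padicValNat_self,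
        Nat.cast_one, mul_one, Int.even_iff]
      rw [Int.ModEq] at hamod
      omega
    · haveI := Fact.mk hp
      rw [show (2 : ℚ) = ((2 : ℕ) : ℚ) by norm_num, padicValRat.of_nat,
        padicValNat_primes hp2, Nat.cast_zero, mul_zero, sub_zero]
      exact h p hp hp2 hpq
  have habs : |r| = 2 ^ a * |r'| := by
    rw [hr', abs_div, abs_of_pos (by positivity : (0 : ℚ) < 2 ^ a), mul_div_cancel₀ _ h2a]
  refine ⟨a, u, ha1, hamod, ?_⟩
  rcases hu with hu | hu
  · exact Or.inl (by rw [habs, hu])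
  · exact Or.inr (by rw [habs, hu]; ring)

/-! ### The curve `480a1 : y² = x(x + 2)(x - 3)`: the arithmetic of the `2`-descent over `ℚ` -/

/-- On `480a1`, `y² = (x - 0)(x - (-2))(x - 3)`. [folklore] -/
theorem sq_eq_of_equation {x y : ℚ} (h : (curve480a1.baseChange ℚ).toAffine.Equation x y) :
    y ^ 2 = (x - 0) * (x - (-2)) * (x - 3) := by
  rw [equation_iff'] at h
  linear_combination h

/-- An affine point of `480a1` with `y = 0` is one of the three `2`-torsion points
`x ∈ {0, -2, 3}`. [folklore] -/
theorem x_eq_of_y_eq_zero {x y : ℚ} (h : (curve480a1.baseChange ℚ).toAffine.Equation x y)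
    (hy : y = 0) : x = 0 ∨ x = -2 ∨ x = 3 := by
  have hE := sq_eq_of_equation h
  rw [hy, zero_pow two_ne_zero, zero_eq_mul, mul_eq_zero] at hE
  rcases hE with (hE | hE) | hE
  · exact Or.inl (by linarith)
  · exact Or.inr (Or.inl (by linarith))
  · exact Or.inr (Or.inr (by linarith))

/-- **The `2`-descent on `480a1` over `ℚ`, arithmetic core** (Silverman, *AEC*, Example X.1.5
carried out for `y² = x(x + 2)(x - 3)`, `S = {2, 3, 5, ∞}`): for a rational point `(x, y)` with
`y ≠ 0` there are non-zero rationals `u, v` with `(x, x + 2)` one of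
`(u², v²), (3u², 5v²), (-u², v²), (-3u², 5v²), (2u², 10v²), (6u², 2v²), (-2u², 10v²), (-6u², 2v²)`
— the classes of the known points `P = (-1, 2)`, the `2`-torsion, and their sums. Proof:
`ord_p(x)` is even for `p ∉ {2, 3}`, `ord_p(x + 2)` is even for `p ∉ {2, 5}` and `ord_p(x - 3)`
is even for `p ∉ {3, 5}` (`Curve24A1.even_padicValRat_sub`), so `|x| = 2ᵃ{1, 3}u²`,
`x + 2 = 2ᵇ{1, 5}v²` (`exists_abs_eq_two_pow_mul_sq`; `x + 2 > 0` as `y² > 0`), with `a = b` by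
comparing `2`-adic valuations in `y² = x(x + 2)(x - 3)` (`ord₂(x - 3)` is even); of the `16`
remaining sign/class combinations, eight are excluded by a `3`-adic or `5`-adic obstruction on
the corresponding homogeneous space, in the elementary form of an infinite descent
(`eq_zero_of_sq_descent_prime_rat`): `u² + 2 = 5v²`, `2 - u² = 5v²`, `3u² + 1 = 5v²`,
`1 - 3u² = 5v²` (mod `5`: `±2, ±3` are non-squares) and `3u² + 2 = v²`, `2 - 3u² = v²`,
`2u² - 3 = w²`, `2u² + 3 = w²` (mod `3`: `2` is a non-square).
[cite: SilvermanAEC2009, Example X.1.5 (method)] -/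
theorem exists_eq_mul_sq_of_equation {x y : ℚ} (h : (curve480a1.baseChange ℚ).toAffine.Equation x y)
    (hy : y ≠ 0) :
    ∃ u v : ℚ, u ≠ 0 ∧ v ≠ 0 ∧
      ((x = u ^ 2 ∧ x + 2 = v ^ 2) ∨ (x = 3 * u ^ 2 ∧ x + 2 = 5 * v ^ 2) ∨
        (x = -u ^ 2 ∧ x + 2 = v ^ 2) ∨ (x = -(3 * u ^ 2) ∧ x + 2 = 5 * v ^ 2) ∨
        (x = 2 * u ^ 2 ∧ x + 2 = 10 * v ^ 2) ∨ (x = 6 * u ^ 2 ∧ x + 2 = 2 * v ^ 2) ∨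
        (x = -(2 * u ^ 2) ∧ x + 2 = 10 * v ^ 2) ∨ (x = -(6 * u ^ 2) ∧ x + 2 = 2 * v ^ 2)) := by
  -- anisotropy modulo `5` and `3` of the binary forms that occur
  have H₁ : ∀ a b : ZMod 5, ((1 : ℤ) : ZMod 5) * a ^ 2 + ((2 : ℤ) : ZMod 5) * b ^ 2 = 0 →
      a = 0 ∧ b = 0 := by decide
  have H₂ : ∀ a b : ZMod 5, ((2 : ℤ) : ZMod 5) * a ^ 2 + ((-1 : ℤ) : ZMod 5) * b ^ 2 = 0 →
      a = 0 ∧ b = 0 := by decide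
  have H₃ : ∀ a b : ZMod 5, ((3 : ℤ) : ZMod 5) * a ^ 2 + ((1 : ℤ) : ZMod 5) * b ^ 2 = 0 →
      a = 0 ∧ b = 0 := by decide
  have H₄ : ∀ a b : ZMod 5, ((1 : ℤ) : ZMod 5) * a ^ 2 + ((-3 : ℤ) : ZMod 5) * b ^ 2 = 0 →
      a = 0 ∧ b = 0 := by decide
  have H₅ : ∀ a b : ZMod 3, ((1 : ℤ) : ZMod 3) * a ^ 2 + ((-2 : ℤ) : ZMod 3) * b ^ 2 = 0 →
      a = 0 ∧ b = 0 := by decide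
  have H₆ : ∀ a b : ZMod 3, ((2 : ℤ) : ZMod 3) * a ^ 2 + ((-1 : ℤ) : ZMod 3) * b ^ 2 = 0 →
      a = 0 ∧ b = 0 := by decide
  have hγ₅ : ¬((5 : ℕ) : ℤ) ∣ 1 := by decide
  have hγ₃ : ¬((3 : ℕ) : ℤ) ∣ 1 := by decide
  have hγ₃' : ¬((3 : ℕ) : ℤ) ∣ -1 := by decide
  haveI : Fact (Nat.Prime 2) := ⟨Nat.prime_two⟩
  haveI : Fact (Nat.Prime 3) := ⟨Nat.prime_three⟩
  haveI : Fact (Nat.Prime 5) := ⟨Nat.prime_five⟩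
  have hE := sq_eq_of_equation h
  have hE₂ : y ^ 2 = (x - (-2)) * (x - 0) * (x - 3) := by rw [hE]; ring
  have hE₃ : y ^ 2 = (x - 3) * (x - 0) * (x - (-2)) := by rw [hE]; ring
  have h₀ : (x - 0) * (x - (-2)) * (x - 3) ≠ 0 := hE ▸ pow_ne_zero 2 hy
  have hx₁ : x - 0 ≠ 0 := fun h0 => h₀ (by rw [h0, zero_mul, zero_mul])
  have hx₂ : x - (-2) ≠ 0 := fun h0 => h₀ (by rw [h0, mul_zero, zero_mul])
  have hx₃ : x - 3 ≠ 0 := fun h0 => h₀ (by rw [h0, mul_zero])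
  -- parities of valuations
  have P1 : ∀ p : ℕ, p.Prime → p ≠ 2 → p ≠ 3 → Even (padicValRat p (x - 0)) :=
    fun p hp hp2 hp3 => by
      haveI := Fact.mk hp
      refine even_padicValRat_sub p (by norm_num) (by norm_num) ?_ ?_ hy hE
      · rw [show (0 : ℚ) - (-2) = ((2 : ℕ) : ℚ) by norm_num, padicValRat.of_nat,
          padicValNat_primes hp2, Nat.cast_zero]
      · rw [show (0 : ℚ) - 3 = -((3 : ℕ) : ℚ) by norm_num, padicValRat.neg, padicValRat.of_nat,
          padicValNat_primes hp3, Nat.cast_zero]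
  have P2 : ∀ p : ℕ, p.Prime → p ≠ 2 → p ≠ 5 → Even (padicValRat p (x - (-2))) :=
    fun p hp hp2 hp5 => by
      haveI := Fact.mk hp
      refine even_padicValRat_sub p (by norm_num) (by norm_num) ?_ ?_ hy hE₂
      · rw [show (-2 : ℚ) - 0 = -((2 : ℕ) : ℚ) by norm_num, padicValRat.neg, padicValRat.of_nat,
          padicValNat_primes hp2, Nat.cast_zero]
      · rw [show (-2 : ℚ) - 3 = -((5 : ℕ) : ℚ) by norm_num, padicValRat.neg, padicValRat.of_nat,
          padicValNat_primes hp5, Nat.cast_zero]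
  have P3 : Even (padicValRat 2 (x - 3)) := by
    refine even_padicValRat_sub 2 (by norm_num) (by norm_num) ?_ ?_ hy hE₃
    · rw [show (3 : ℚ) - 0 = ((3 : ℕ) : ℚ) by norm_num, padicValRat.of_nat,
        padicValNat_primes (by norm_num), Nat.cast_zero]
    · rw [show (3 : ℚ) - (-2) = ((5 : ℕ) : ℚ) by norm_num, padicValRat.of_nat,
        padicValNat_primes (by norm_num), Nat.cast_zero]
  -- the `2`-adic coupling: `ord₂ x + ord₂ (x + 2)` is even
  have hpar : Even (padicValRat 2 (x - 0) + padicValRat 2 (x - (-2))) := by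
    have key := congrArg (padicValRat 2) hE
    rw [padicValRat.pow, padicValRat.mul (mul_ne_zero hx₁ hx₂) hx₃, padicValRat.mul hx₁ hx₂]
      at key
    obtain ⟨k, hk⟩ := P3
    exact ⟨padicValRat 2 y - k, by push_cast at key ⊢; omega⟩
  -- `x + 2 > 0`
  have hy2 : 0 < (x - 0) * (x - (-2)) * (x - 3) := by rw [← hE]; positivity
  have hpos₂ : 0 < x - (-2) := by
    by_contra hle
    push Not at hle
    have h1 : x - 0 < 0 := by linarith
    have h3 : x - 3 < 0 := by linarith
    nlinarith [mul_pos_of_neg_of_neg h1 h3]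
  -- square classes of `|x|`, `x + 2`
  obtain ⟨a, u, ha1, hamod, hu⟩ := exists_abs_eq_two_pow_mul_sq hx₁ 3 fun p hp hp2 hp3 =>
    P1 p hp hp2 hp3
  obtain ⟨b, v, hb1, hbmod, hv⟩ := exists_abs_eq_two_pow_mul_sq hx₂ 5 fun p hp hp2 hp5 =>
    P2 p hp hp2 hp5
  push_cast at hu hv
  rw [abs_of_pos hpos₂] at hv
  have hab : a = b := by
    rw [Int.ModEq] at hamod hbmod
    rw [Int.even_iff] at hpar
    omega
  subst hab
  have hu0 : u ≠ 0 := by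
    rintro rfl
    have : |x - 0| = 0 := by rcases hu with hu | hu <;> rw [hu] <;> ring
    exact hx₁ (abs_eq_zero.mp this)
  have hv0 : v ≠ 0 := by
    rintro rfl
    have : x - (-2) = 0 := by rcases hv with hv | hv <;> rw [hv] <;> ring
    exact hx₂ this
  interval_cases a
  · -- `a = 0`: `|x| ∈ {u², 3u²}`, `x + 2 ∈ {v², 5v²}`
    simp only [pow_zero, one_mul] at hu hv
    rcases lt_or_gt_of_ne hx₁ with hneg | hpos
    · rw [abs_of_neg hneg] at hu
      rcases hu with hu | hu <;> rcases hv with hv | hv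
      · -- `(-u², v²)`
        exact ⟨u, v, hu0, hv0, Or.inr (Or.inr (Or.inl ⟨by linarith, by linarith⟩))⟩
      · -- `(-u², 5v²)`: `2 - u² = 5v²`
        exfalso
        have key := eq_zero_of_sq_descent_prime_rat 5 H₂ hγ₅ (a := 1) (b := u) (c := v)
          (by push_cast; linarith)
        exact one_ne_zero key.1
      · -- `(-3u², v²)`: `v² - 2 = -3u²`
        exfalso
        have key := eq_zero_of_sq_descent_prime_rat 3 H₅ hγ₃' (a := v) (b := 1) (c := u)
          (by push_cast; linarith)
        exact one_ne_zero key.2.1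
      · -- `(-3u², 5v²)`
        exact ⟨u, v, hu0, hv0, Or.inr (Or.inr (Or.inr (Or.inl ⟨by linarith, by linarith⟩)))⟩
    · rw [abs_of_pos hpos] at hu
      rcases hu with hu | hu <;> rcases hv with hv | hv
      · -- `(u², v²)`
        exact ⟨u, v, hu0, hv0, Or.inl ⟨by linarith, by linarith⟩⟩
      · -- `(u², 5v²)`: `u² + 2 = 5v²`
        exfalso
        have key := eq_zero_of_sq_descent_prime_rat 5 H₁ hγ₅ (a := u) (b := 1) (c := v)
          (by push_cast; linarith)
        exact one_ne_zero key.2.1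
      · -- `(3u², v²)`: `v² - 2 = 3u²`
        exfalso
        have key := eq_zero_of_sq_descent_prime_rat 3 H₅ hγ₃ (a := v) (b := 1) (c := u)
          (by push_cast; linarith)
        exact one_ne_zero key.2.1
      · -- `(3u², 5v²)`
        exact ⟨u, v, hu0, hv0, Or.inr (Or.inl ⟨by linarith, by linarith⟩)⟩
  · -- `a = 1`: `|x| ∈ {2u², 6u²}`, `x + 2 ∈ {2v², 10v²}`
    simp only [pow_one] at hu hv
    rcases lt_or_gt_of_ne hx₁ with hneg | hpos
    · rw [abs_of_neg hneg] at hu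
      rcases hu with hu | hu <;> rcases hv with hv | hv
      · -- `(-2u², 2v²)`: `x - 3 = -w²`, `w² - 2u² = 3`
        exfalso
        have hy' : y ^ 2 = -(4 * u ^ 2 * v ^ 2 * (x - 3)) := by
          rw [hE, show x - 0 = -(2 * u ^ 2) by linarith, show x - (-2) = 2 * v ^ 2 by linarith]
          ring
        have hw : x - 3 = -(y / (2 * u * v)) ^ 2 := by
          field_simp
          linear_combination hy'
        have key := eq_zero_of_sq_descent_prime_rat 3 H₅ hγ₃ (a := y / (2 * u * v)) (b := u)
          (c := 1) (by push_cast; linarith)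
        exact one_ne_zero key.2.2
      · -- `(-2u², 10v²)`
        exact ⟨u, v, hu0, hv0,
          Or.inr (Or.inr (Or.inr (Or.inr (Or.inr (Or.inr (Or.inl ⟨by linarith, by linarith⟩))))))⟩
      · -- `(-6u², 2v²)`
        exact ⟨u, v, hu0, hv0,
          Or.inr (Or.inr (Or.inr (Or.inr (Or.inr (Or.inr (Or.inr ⟨by linarith, by linarith⟩))))))⟩
      · -- `(-6u², 10v²)`: `1 - 3u² = 5v²`
        exfalso
        have key := eq_zero_of_sq_descent_prime_rat 5 H₄ hγ₅ (a := 1) (b := u) (c := v)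
          (by push_cast; linarith)
        exact one_ne_zero key.1
    · rw [abs_of_pos hpos] at hu
      rcases hu with hu | hu <;> rcases hv with hv | hv
      · -- `(2u², 2v²)`: `x - 3 = w²`, `2u² - w² = 3`
        exfalso
        have hy' : y ^ 2 = 4 * u ^ 2 * v ^ 2 * (x - 3) := by
          rw [hE, show x - 0 = 2 * u ^ 2 by linarith, show x - (-2) = 2 * v ^ 2 by linarith]
          ring
        have hw : x - 3 = (y / (2 * u * v)) ^ 2 := by
          field_simp
          linear_combination -hy'
        have key := eq_zero_of_sq_descent_prime_rat 3 H₆ hγ₃ (a := u) (b := y / (2 * u * v))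
          (c := 1) (by push_cast; linarith)
        exact one_ne_zero key.2.2
      · -- `(2u², 10v²)`
        exact ⟨u, v, hu0, hv0, Or.inr (Or.inr (Or.inr (Or.inr (Or.inl ⟨by linarith, by linarith⟩))))⟩
      · -- `(6u², 2v²)`
        exact ⟨u, v, hu0, hv0,
          Or.inr (Or.inr (Or.inr (Or.inr (Or.inr (Or.inl ⟨by linarith, by linarith⟩)))))⟩
      · -- `(6u², 10v²)`: `3u² + 1 = 5v²`
        exfalso
        have key := eq_zero_of_sq_descent_prime_rat 5 H₃ hγ₅ (a := u) (b := 1) (c := v)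
          (by push_cast; linarith)
        exact one_ne_zero key.2.1

/-- **The image of the complete `2`-descent on `480a1` over `ℚ`** (Silverman, *AEC*, Prop. X.1.4
and Example X.1.5): for every rational point `P`, the pair of descent components
`(δ₁(P), δ₂(P)) = (x, x + 2) ∈ ℚˣ/ℚˣ² × ℚˣ/ℚˣ²` (with the conventions at `O, T₁, T₂`) is one of
the eight classes `(1, 1), (3, 5), (-1, 1), (-3, 5), (2, 10), (6, 2), (-2, 10), (-6, 2)` — the
images of `O, (3, 0), (-1, ±2), (-1, ±2) + (3, 0), (-1, ±2) + (-2, 0), (-1, ±2) + (0, 0),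
(-2, 0), (0, 0)`. Proof: direct evaluation at `O` and at the `2`-torsion points, and
`exists_eq_mul_sq_of_equation` at the other points. Polymorphic in the `DecidableEq ℚ` argument
of the tree's `twoDescentComponent`. [cite: SilvermanAEC2009, Prop. X.1.4 and Example X.1.5] -/
theorem descentPair_mem [DecidableEq ℚ] (P : (curve480a1.baseChange ℚ).toAffine.Point) :
    (twoDescentComponent (curve480a1.baseChange ℚ).toAffine 0 (-2) 3 P,
      twoDescentComponent (curve480a1.baseChange ℚ).toAffine (-2) 0 3 P) ∈
      ({(1, 1), (sqClass 3, sqClass 5), (sqClass (-1), 1), (sqClass (-3), sqClass 5),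
        (sqClass 2, sqClass 10), (sqClass 6, sqClass 2), (sqClass (-2), sqClass 10),
        (sqClass (-6), sqClass 2)} : Set (SqUnits ℚ × SqUnits ℚ)) := by
  simp only [Set.mem_insert_iff, Set.mem_singleton_iff, Prod.mk.injEq]
  rcases P with _ | ⟨x, y, hP⟩
  · exact Or.inl ⟨rfl, rfl⟩
  · by_cases hx1 : x = 0
    · subst hx1
      refine Or.inr (Or.inr (Or.inr (Or.inr (Or.inr (Or.inr (Or.inr ⟨?_, ?_⟩))))))
      · rw [twoDescentComponent_some_of_eq hP rfl]
        norm_num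
      · rw [twoDescentComponent_some_of_ne hP (by norm_num)]
        norm_num
    by_cases hx2 : x = -2
    · subst hx2
      refine Or.inr (Or.inr (Or.inr (Or.inr (Or.inr (Or.inr (Or.inl ⟨?_, ?_⟩))))))
      · rw [twoDescentComponent_some_of_ne hP (by norm_num)]
        norm_num
      · rw [twoDescentComponent_some_of_eq hP rfl]
        norm_num
    by_cases hx3 : x = 3
    · subst hx3
      refine Or.inr (Or.inl ⟨?_, ?_⟩)
      · rw [twoDescentComponent_some_of_ne hP (by norm_num)]
        norm_num
      · rw [twoDescentComponent_some_of_ne hP (by norm_num)]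
        norm_num
    have hy : y ≠ 0 := fun hy => by
      rcases x_eq_of_y_eq_zero hP.1 hy with h | h | h
      · exact hx1 h
      · exact hx2 h
      · exact hx3 h
    obtain ⟨u, v, hu, hv, hcases⟩ := exists_eq_mul_sq_of_equation hP.1 hy
    rw [twoDescentComponent_some_of_ne hP hx1, twoDescentComponent_some_of_ne hP hx2, sub_zero,
      sub_neg_eq_add]
    rcases hcases with ⟨h1, h2⟩ | ⟨h1, h2⟩ | ⟨h1, h2⟩ | ⟨h1, h2⟩ | ⟨h1, h2⟩ | ⟨h1, h2⟩ |
        ⟨h1, h2⟩ | ⟨h1, h2⟩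
    · refine Or.inl ⟨?_, ?_⟩
      · rw [h1, sqClass_sq]
      · rw [h2, sqClass_sq]
    · refine Or.inr (Or.inl ⟨?_, ?_⟩)
      · rw [h1, sqClass_mul_sq (by norm_num) hu]
      · rw [h2, sqClass_mul_sq (by norm_num) hv]
    · refine Or.inr (Or.inr (Or.inl ⟨?_, ?_⟩))
      · rw [h1, show -u ^ 2 = -1 * u ^ 2 by ring, sqClass_mul_sq (by norm_num) hu]
      · rw [h2, sqClass_sq]
    · refine Or.inr (Or.inr (Or.inr (Or.inl ⟨?_, ?_⟩)))
      · rw [h1, show -(3 * u ^ 2) = -3 * u ^ 2 by ring, sqClass_mul_sq (by norm_num) hu]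
      · rw [h2, sqClass_mul_sq (by norm_num) hv]
    · refine Or.inr (Or.inr (Or.inr (Or.inr (Or.inl ⟨?_, ?_⟩))))
      · rw [h1, sqClass_mul_sq (by norm_num) hu]
      · rw [h2, sqClass_mul_sq (by norm_num) hv]
    · refine Or.inr (Or.inr (Or.inr (Or.inr (Or.inr (Or.inl ⟨?_, ?_⟩)))))
      · rw [h1, sqClass_mul_sq (by norm_num) hu]
      · rw [h2, sqClass_mul_sq (by norm_num) hv]
    · refine Or.inr (Or.inr (Or.inr (Or.inr (Or.inr (Or.inr (Or.inl ⟨?_, ?_⟩))))))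
      · rw [h1, show -(2 * u ^ 2) = -2 * u ^ 2 by ring, sqClass_mul_sq (by norm_num) hu]
      · rw [h2, sqClass_mul_sq (by norm_num) hv]
    · refine Or.inr (Or.inr (Or.inr (Or.inr (Or.inr (Or.inr (Or.inr ⟨?_, ?_⟩))))))
      · rw [h1, show -(6 * u ^ 2) = -6 * u ^ 2 by ring, sqClass_mul_sq (by norm_num) hu]
      · rw [h2, sqClass_mul_sq (by norm_num) hv]

/-! ### Rank at most `1`, hence exactly `1` -/

/-- **`480a1` has Mordell–Weil rank `≤ 1` over `ℚ`**, by the complete `2`-descent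
(Silverman, *AEC*, Prop. X.1.4, Example X.1.5): the `2`-descent map `δ` (tree `twoDescentMap`,
kernel `2E(ℚ)`) takes at most the `8` values of `descentPair_mem`, while by the counting lemma
`pow_finrank_add_two_le_natCard_range` (with the `2`-torsion points `T₁ = (0, 0)` and
`T₂ = (-2, 0)`, which `δ` separates: `δ(T₁) = (-6, 2)`, `δ(T₂) = (-2, 10)`,
`δ(T₁ + T₂) = (3, 5)`, none trivial as `2, 10, 5` are not rational squares) it takes at least
`2^(r + 2)` values, `r = rank_ℤ E(ℚ)` (Mordell–Weil, tree `module_finite_point_holds`); so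
`2^(r + 2) ≤ 8` and `r ≤ 1`. (The source obtains `rk E/F₅ = 1 ⊇ rk E/ℚ` by `2`-descent in
Magma; Cremona's tables list `480a1` with `r = 1`.)
[cite: DokchitserDokchitser2011RankModN, proof of Thm. 2] -/
theorem mordellWeilRank_le_one : (curve480a1.baseChange ℚ).mordellWeilRank ≤ 1 := by
  letI := Classical.decEq ℚ
  haveI := isElliptic
  haveI : Module.Finite ℤ (curve480a1.baseChange ℚ).toAffine.Point :=
    WeierstrassCurve.module_finite_point_holds (W := curve480a1.baseChange ℚ)
  have h := splitTwoTorsion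
  set ψ := twoDescentMap h with hψ
  -- the torsion points `T₁ = (0, 0)`, `T₂ = (-2, 0)`
  have hns : ∀ {a b : ℚ}, (curve480a1.baseChange ℚ).toAffine.Equation a b →
      (curve480a1.baseChange ℚ).toAffine.Nonsingular a b :=
    fun hab => equation_iff_nonsingular.mp hab
  have hT₁ : (curve480a1.baseChange ℚ).toAffine.Nonsingular 0 0 :=
    hns ((equation_iff' 0 0).mpr (by norm_num))
  have hT₂ : (curve480a1.baseChange ℚ).toAffine.Nonsingular (-2) 0 :=
    hns ((equation_iff' (-2) 0).mpr (by norm_num))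
  set T₁ : (curve480a1.baseChange ℚ).toAffine.Point := .some 0 0 hT₁ with hT₁def
  set T₂ : (curve480a1.baseChange ℚ).toAffine.Point := .some (-2) 0 hT₂ with hT₂def
  -- `2`, `5` and `10` are not squares
  have h2sq : sqClass (2 : ℚ) ≠ 1 := sqClass_ne_one (by norm_num) not_isSquare_two
  have h5sq : sqClass (5 : ℚ) ≠ 1 := sqClass_ne_one (by norm_num) not_isSquare_five
  have h10sq : sqClass (10 : ℚ) ≠ 1 := sqClass_ne_one (by norm_num) not_isSquare_ten
  -- values of `ψ`
  have hψT₁ : ψ T₁ = Additive.ofMul (sqClass ((0 - (-2)) * (0 - 3)), sqClass (0 - (-2))) := by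
    rw [hψ, twoDescentMap_apply, twoDescentComponent_some_of_eq hT₁ rfl,
      twoDescentComponent_some_of_ne hT₁ (by norm_num)]
  have hψT₂ : ψ T₂ = Additive.ofMul (sqClass (-2 - 0), sqClass ((-2 - 0) * (-2 - 3))) := by
    rw [hψ, twoDescentMap_apply, twoDescentComponent_some_of_ne hT₂ (by norm_num),
      twoDescentComponent_some_of_eq hT₂ rfl]
  have h₁ : ψ T₁ ≠ 0 := by
    rw [hψT₁, Ne, ofMul_eq_zero, Prod.mk_eq_one, not_and_or]
    exact Or.inr (by norm_num; exact h2sq)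
  have h₂ : ψ T₂ ≠ 0 := by
    rw [hψT₂, Ne, ofMul_eq_zero, Prod.mk_eq_one, not_and_or]
    exact Or.inr (by norm_num; exact h10sq)
  have h₃ : ψ (T₁ + T₂) ≠ 0 := by
    rw [map_add, hψT₁, hψT₂, ← ofMul_mul, Prod.mk_mul_mk, Ne, ofMul_eq_zero, Prod.mk_eq_one,
      not_and_or]
    refine Or.inr ?_
    rw [← sqClass_mul (by norm_num) (by norm_num)]
    norm_num
    rw [show (20 : ℚ) = 5 * 2 ^ 2 by norm_num, sqClass_mul_sq (by norm_num) two_ne_zero]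
    exact h5sq
  have h₁₂ : ψ T₁ ≠ ψ T₂ := by
    rw [hψT₁, hψT₂, Ne, Additive.ofMul.apply_eq_iff_eq, Prod.mk.injEq, not_and_or]
    refine Or.inr fun heq => h5sq ?_
    have key : sqClass ((0 : ℚ) - (-2)) * sqClass ((-2 - 0) * (-2 - 3)) = 1 := by
      rw [heq, SqUnits.mul_self]
    rw [← sqClass_mul (by norm_num) (by norm_num)] at key
    norm_num at key
    rwa [show (20 : ℚ) = 5 * 2 ^ 2 by norm_num, sqClass_mul_sq (by norm_num) two_ne_zero] at key
  -- the kernel of `ψ` is `2E(ℚ)`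
  have hker : ∀ a, ψ a = 0 → ∃ b, a = 2 • b := fun a ha => by
    have ha' : a ∈ ψ.ker := ha
    rw [hψ, ker_twoDescentMap h] at ha'
    obtain ⟨b, hb⟩ := ha'
    exact ⟨b, hb.symm⟩
  -- finite order of `T₁` and `T₂`
  have hfin₁ : IsOfFinAddOrder T₁ := by
    refine isOfFinAddOrder_iff_nsmul_eq_zero.mpr ⟨2, two_pos, ?_⟩
    rw [two_nsmul, hT₁def]
    exact add_self_of_Y_eq (by rw [negY, E_a₁, E_a₃]; ring)
  have hfin₂ : IsOfFinAddOrder T₂ := by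
    refine isOfFinAddOrder_iff_nsmul_eq_zero.mpr ⟨2, two_pos, ?_⟩
    rw [two_nsmul, hT₂def]
    exact add_self_of_Y_eq (by rw [negY, E_a₁, E_a₃]; ring)
  -- the range of `ψ` has at most `8` elements
  set S : Set (SqUnits ℚ × SqUnits ℚ) := {(1, 1), (sqClass 3, sqClass 5), (sqClass (-1), 1),
    (sqClass (-3), sqClass 5), (sqClass 2, sqClass 10), (sqClass 6, sqClass 2),
    (sqClass (-2), sqClass 10), (sqClass (-6), sqClass 2)} with hS
  have hSfin : S.Finite := by
    rw [hS]
    exact (((((((Set.finite_singleton _).insert _).insert _).insert _).insert _).insert _).insert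
      _).insert _
  have hS8 : S.ncard ≤ 8 := by
    rw [hS]
    refine (Set.ncard_insert_le _ _).trans ?_
    rw [Nat.succ_le_succ_iff]
    refine (Set.ncard_insert_le _ _).trans ?_
    rw [Nat.succ_le_succ_iff]
    refine (Set.ncard_insert_le _ _).trans ?_
    rw [Nat.succ_le_succ_iff]
    refine (Set.ncard_insert_le _ _).trans ?_
    rw [Nat.succ_le_succ_iff]
    refine (Set.ncard_insert_le _ _).trans ?_
    rw [Nat.succ_le_succ_iff]
    refine (Set.ncard_insert_le _ _).trans ?_
    rw [Nat.succ_le_succ_iff]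
    refine (Set.ncard_insert_le _ _).trans ?_
    rw [Nat.succ_le_succ_iff, Set.ncard_singleton]
  have hsub : Set.range ψ ⊆ Additive.ofMul '' S := by
    rintro _ ⟨P, rfl⟩
    exact ⟨_, descentPair_mem P, by rw [hψ]; exact (twoDescentMap_apply h P).symm⟩
  have hTfin : (Additive.ofMul '' S).Finite := hSfin.image _
  haveI : Finite ψ.range := (hTfin.subset (by rw [AddMonoidHom.coe_range]; exact hsub)).to_subtype
  have hcard : Nat.card ψ.range ≤ 8 := by
    rw [← SetLike.coe_sort_coe, Nat.card_coe_set_eq, AddMonoidHom.coe_range]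
    calc (Set.range ψ).ncard ≤ (Additive.ofMul '' S).ncard := Set.ncard_le_ncard hsub hTfin
      _ ≤ S.ncard := Set.ncard_image_le hSfin
      _ ≤ 8 := hS8
  -- counting: `2 ^ (r + 2) ≤ 8`
  have hbound := pow_finrank_add_two_le_natCard_range ψ hker hfin₁ hfin₂ h₁ h₂ h₃ h₁₂
  have hle : 2 ^ (Module.finrank ℤ (curve480a1.baseChange ℚ).toAffine.Point + 2) ≤ 2 ^ 3 :=
    hbound.trans hcard
  have := (Nat.pow_le_pow_iff_right (by norm_num)).mp hle
  unfold WeierstrassCurve.mordellWeilRank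
  omega

/-- `nP ≠ O` for `P = (-1, 2)` and `n > 0` (`nsmul_P_ne_zero`), for an arbitrary `DecidableEq ℚ`
instance behind Mathlib's group law on points (the tree's `WeierstrassCurve.mordellWeilRank` uses
the classical one, `nsmul_P_ne_zero` the computable one; the two group structures agree because
`DecidableEq ℚ` is a subsingleton). [folklore] -/
theorem nsmul_P_ne_zero' [inst : DecidableEq ℚ] {n : ℕ} (hn : 0 < n) :
    n • (Point.some (-1) 2 nonsingular_P : (curve480a1.baseChange ℚ).toAffine.Point) ≠ 0 := by
  have e : inst = instDecidableEqRat := Subsingleton.elim _ _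
  subst e
  exact nsmul_P_ne_zero hn

/-- **`480a1` has Mordell–Weil rank exactly `1` over `ℚ`** (`rank_ℤ E(ℚ) = 1`, Cremona's table
entry for `480a1`, certified): `≤ 1` by the complete `2`-descent (`mordellWeilRank_le_one`) and
`≥ 1` because `P = (-1, 2)` has infinite order (`nsmul_P_ne_zero`, so `{P}` is `ℤ`-linearly
independent in the finitely generated group `E(ℚ)`). In the source this is the case `K = ℚ`
underlying "`rk E/F₃ = rk E/F₅ = 1`". [cite: DokchitserDokchitser2011RankModN, proof of Thm. 2] -/
theorem mordellWeilRank_eq_one : (curve480a1.baseChange ℚ).mordellWeilRank = 1 := by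
  refine le_antisymm mordellWeilRank_le_one ?_
  letI := Classical.decEq ℚ
  haveI := isElliptic
  haveI : Module.Finite ℤ (curve480a1.baseChange ℚ).toAffine.Point :=
    WeierstrassCurve.module_finite_point_holds (W := curve480a1.baseChange ℚ)
  set P₀ : (curve480a1.baseChange ℚ).toAffine.Point := Point.some (-1) 2 nonsingular_P with hP₀
  have key : ∀ c : ℤ, c • P₀ = 0 → c = 0 := fun c hc => by
    by_contra hc0
    have h1 : ((c.natAbs : ℕ) : ℤ) • P₀ = 0 := by
      rcases Int.natAbs_eq c with h | h
      · rw [← h]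
        exact hc
      · rw [show ((c.natAbs : ℕ) : ℤ) = -c by omega, neg_smul, hc, _root_.neg_zero]
    have h2 : c.natAbs • P₀ = 0 := by
      rw [natCast_zsmul] at h1
      exact h1
    exact nsmul_P_ne_zero' (Int.natAbs_pos.mpr hc0) (by rw [← hP₀]; exact h2)
  have hli : LinearIndependent ℤ ![P₀] := by
    refine Fintype.linearIndependent_iff.mpr fun g hg i => ?_
    rw [Fin.sum_univ_one, Matrix.cons_val_fin_one] at hg
    rw [Subsingleton.elim i 0]
    exact key (g 0) hg
  have := hli.fintype_card_le_finrank
  rw [Fintype.card_fin] at this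
  unfold WeierstrassCurve.mordellWeilRank
  exact this

end curve480a1

end Literature.Barriers.BirchSwinnertonDyer

end
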